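import Summits.NavierStokesRegularity.FunctionalMining.NoGo.TopEigHeatFrameDensity
import Summits.NavierStokesRegularity.FunctionalMining.NoGo.TopEigAmplitudeFloorLow
import HarnessLib

/-!
# FunctionalMining / NoGo — K64: the FRAME COST BELOW `q = 2` (every real `q > 1`): non-negativity,
# the Fatou upper bound on `t⁻² F_t`, and the localisation on the simple set

HONEST FRAMING. Search for candidate a priori estimates; no regularity claim. Nothing about
Navier–Stokes is proved or asserted in this file. Cell `pub-nsfunc`, no-go seat (gen 54, touch 4).
Static calculus of smooth fields on the flat torus.

CONTEXT. K62 (`NoGo/TopEigHeatFrameFloor`) splits the heat price of `Φ_q = ∫ λ₁(S)^q` into the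
amplitude integral `AF_q(v) = Σᵢ ∫ q(q−1)λ^{q−2}(∂ᵢλ)²` and the FRAME COST `FC_q(v) := heat − AF_q(v)`,
and shows `t⁻² F_t → FC_q(v)` (`F_t = ∫ qλ^{q−1} FD_t`, the weighted discrete frame defect) and
`FC_q ≥ 0` — for `q ≥ 2` only (dominated convergence of the slope integral `A_t`). K63
(`NoGo/TopEigHeatFrameDensity`) localises: `∫_{λ₂<λ₁} qλ₁^{q−1} fd ≤ FC_q(v)`, again `q ≥ 2`. K57a
(`NoGo/TopEigAmplitudeFloorLow`) proved the amplitude floor on the WHOLE range `q > 1` by Fatou.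

CONTENT (smooth divergence-free `v`; §§ 1–3 on `T^d` for every finite `d`, § 4 on `T³`), every real `q > 1`:
§ 1 `amplitudeIntegral_eq_integral` (K62ʼs axis-by-axis `AF_q` IS K57aʼs floor integral; each axis
term integrable), **`amplitudeIntegral_le_heatDissipation_of_one_lt`**, **`frameCost_nonneg_of_one_lt`**
(`0 ≤ FC_q(v)` ∀ real `q > 1`, every dimension); § 2 **`eventually_amplitudeIntegral_sub_le_slopeIntegral`**:
`∀ ε > 0, ∀ᶠ t → 0⁺, AF_q(v) − ε ≤ A_t` (Fatou per axis, K57aʼs Rademacher/Fermat identification of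
the lower limit — the `liminf` form of the treeʼs `q ≥ 2` limit `A_t → AF_q`); § 3
**`eventually_frameIntegral_div_sq_le`**: `∀ ε > 0, ∀ᶠ t → 0⁺, t⁻² F_t ≤ FC_q(v) + ε` (K62ʼs two-sided
discrete frame identity + § 2) — the frame cost BOUNDS the weighted frame defect from above in the
limit for every `q > 1`, with `t⁻² F_t → FC_q` when `q ≥ 2` (K62); § 4 (T³) the localisation ∀ real
`q > 1`: **`setIntegral_simpleSet_frameDensity_le_frameCost_of_one_lt`** (`qλ₁^{q−1} fd` integrable on
the open simple set `U_s(v) = {λ₂ < λ₁}` with `∫_{U_s} qλ₁^{q−1} fd ≤ FC_q(v)`; Fatou + § 3) and the KILL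
RULE ∀ real `q > 1`: **`amplitude_le_and_frameCost_le_of_heat_le_of_one_lt`**,
**`setIntegral_simpleSet_frameDensity_le_of_heat_le_of_one_lt`** (heat `≤ cΦ_q(v)` ⟹ `AF_q ≤ cΦ_q`,
`FC_q ≤ cΦ_q`, `∫_{U_s} qλ₁^{q−1} fd ≤ cΦ_q`). So the K62/K63 door-(e) bookkeeping holds on the whole
range of the open node L-λ(q), in particular near `q = 1`.

NOT CLAIMED: convergence of `A_t` or of `t⁻² F_t` for `1 < q < 2` (only `liminf A_t ≥ AF_q`,
`limsup t⁻² F_t ≤ FC_q`); the share of `{λ₂ = λ₁}` in `FC_q`; any verdict — L-λ(q)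
(`TopEigHeatCoercivePos q`) is OPEN in the kernel ∀ real `q > 1`; door (b) on paper: RULING (ζζ); no
𝒦₀ row, no A12 count, no T_LD. [ours = §§ 1–4; folklore = Fatou, Rademacher (cited through K57a)]
FILING (prove seat g30, REQUEST #93): declarations byte-identical to the no-go seat's staged `TopEigHeatFrameCostLow.STAGING.lean` 8eb8bbb5f2b79311; this line is the only addition.
-/

noncomputable section
open MeasureTheory Set Filter Topology
open scoped ENNReal NNReal

namespace Summit.NavierStokesRegularity.FunctionalMining

open Literature.Analysis.FunctionSpaces Literature.Analysis.FluidPDE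

namespace TopEig

namespace FrameFloor

open StrainL4 FloorLow

section AnyDim

variable {d : Type*} [Fintype d] [DecidableEq d] [Nonempty d]
variable {v : UnitAddTorus d → EuclideanSpace ℝ d} {q : ℝ}

/-! ## § 1 The amplitude integral and the frame cost below `q = 2` -/

/-- Each axis term `q(q−1)λ^{q−2}(∂ᵢλ)²` of `AF_q` is integrable for `q > 1` (it is measurable,
non-negative and below K57aʼs integrable floor integrand). [ours, bookkeeping] -/
theorem integrable_amplitudeTerm (hq : 1 < q) (hv : Torus.IsSmooth v) (hdv : Torus.IsDivFree v)
    (i : d) : Integrable (fun x => q * (q - 1) * torusStrainTopEig v x ^ (q - 2) *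
      Torus.partialDeriv i (torusStrainTopEig v) x ^ 2) volume := by
  set L := torusStrainTopEig v with hL
  have hLc : Continuous L := continuous_torusStrainTopEig hv
  have hLnn : ∀ y, 0 ≤ L y := fun y => by
    rw [hL, ← lam_strainFlat]; exact lam_strainFlat_nonneg hv hdv y
  have hg := (integrable_floorIntegrand_and_integral_le hq hv hdv).1
  have hfm : AEStronglyMeasurable (fun x => q * (q - 1) * L x ^ (q - 2) *
      Torus.partialDeriv i L x ^ 2) volume :=
    ((measurable_const.mul (hLc.measurable.pow_const _)).mul
      ((measurable_partialDeriv_of_continuous hLc i).pow_const _)).aestronglyMeasurable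
  refine hg.mono' hfm (ae_of_all _ fun x => ?_)
  have hq0 : 0 ≤ q * (q - 1) := mul_nonneg (by linarith) (by linarith)
  have hterm : 0 ≤ q * (q - 1) * L x ^ (q - 2) * Torus.partialDeriv i L x ^ 2 :=
    mul_nonneg (mul_nonneg hq0 (Real.rpow_nonneg (hLnn x) _)) (sq_nonneg _)
  rw [Real.norm_eq_abs, abs_of_nonneg hterm, mul_assoc]
  refine mul_le_mul_of_nonneg_left (mul_le_mul_of_nonneg_left ?_ (Real.rpow_nonneg (hLnn x) _)) hq0
  exact Finset.single_le_sum (f := fun j => Torus.partialDeriv j L x ^ 2) (fun j _ => sq_nonneg _)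
    (Finset.mem_univ i)

/-- K62ʼs axis-by-axis amplitude integral IS K57aʼs floor integral (`q > 1`):
`AF_q(v) = ∫ q(q−1) λ^{q−2} Σᵢ(∂ᵢλ)²`. [ours, bookkeeping] -/
theorem amplitudeIntegral_eq_integral (hq : 1 < q) (hv : Torus.IsSmooth v) (hdv : Torus.IsDivFree v) :
    amplitudeIntegral q v = ∫ x, q * (q - 1) * (torusStrainTopEig v x ^ (q - 2) *
      ∑ i, Torus.partialDeriv i (torusStrainTopEig v) x ^ 2) := by
  unfold amplitudeIntegral
  rw [← integral_finsetSum _ fun i _ => integrable_amplitudeTerm hq hv hdv i]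
  refine integral_congr_ae (ae_of_all _ fun x => ?_)
  simp only [Finset.mul_sum]
  exact Finset.sum_congr rfl fun i _ => by ring

/-- **The amplitude floor in K62ʼs variables, whole range:** `AF_q(v) ≤ heatDissipation Φ_q v` for every
real `q > 1` and every dimension (K57a). [ours, bookkeeping] -/
theorem amplitudeIntegral_le_heatDissipation_of_one_lt (hq : 1 < q) (hv : Torus.IsSmooth v)
    (hdv : Torus.IsDivFree v) : amplitudeIntegral q v ≤ heatDissipation (torusTopEigMoment q) v := by
  rw [amplitudeIntegral_eq_integral hq hv hdv]
  exact (integrable_floorIntegrand_and_integral_le hq hv hdv).2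

/-- **THE FRAME COST IS NON-NEGATIVE ON THE WHOLE RANGE** `q > 1` (every dimension). [ours] -/
theorem frameCost_nonneg_of_one_lt (hq : 1 < q) (hv : Torus.IsSmooth v) (hdv : Torus.IsDivFree v) :
    0 ≤ frameCost q v := by
  have h := amplitudeIntegral_le_heatDissipation_of_one_lt hq hv hdv
  unfold frameCost; linarith

/-! ## § 2 Fatou for the slope integral: `liminf A_t ≥ AF_q`, every real `q > 1` -/

/-- Per axis: `∀ δ > 0, ∀ᶠ t → 0⁺, ∫ q(q−1)λ^{q−2}(∂ᵢλ)² − δ ≤ ∫ [(φ(x+teᵢ)−φ(x))/t]·[(λ(x+teᵢ)−λ(x))/t]`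
(`φ = qλ^{q−1}`): Fatou along `𝓝[>] 0` for the non-negative slope products, whose lower limit is the
axis term a.e. (K57a: Rademacher points with `λ > 0`; Fermat at the zeros of `λ`). [ours] -/
theorem eventually_integral_amplitudeTerm_sub_le (hq : 1 < q) (hv : Torus.IsSmooth v)
    (hdv : Torus.IsDivFree v) (i : d) {δ : ℝ} (hδ : 0 < δ) :
    ∀ᶠ t in 𝓝[>] (0 : ℝ),
      (∫ x, q * (q - 1) * torusStrainTopEig v x ^ (q - 2) * Torus.partialDeriv i (torusStrainTopEig v) x ^ 2)
          - δ ≤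
        ∫ x, (q * torusStrainTopEig v (x + Torus.proj (t • EuclideanSpace.single i (1 : ℝ))) ^ (q - 1) -
            q * torusStrainTopEig v x ^ (q - 1)) / t *
          ((torusStrainTopEig v (x + Torus.proj (t • EuclideanSpace.single i (1 : ℝ))) -
            torusStrainTopEig v x) / t) := by
  set L := torusStrainTopEig v with hL
  have hLc : Continuous L := continuous_torusStrainTopEig hv
  have hLnn : ∀ y, 0 ≤ L y := fun y => by
    rw [hL, ← lam_strainFlat]; exact lam_strainFlat_nonneg hv hdv y
  obtain ⟨K, hK⟩ := exists_lipschitzWith_torusStrainTopEig hv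
  set G : ℝ → UnitAddTorus d → ℝ := fun t x =>
    (q * L (x + Torus.proj (t • EuclideanSpace.single i (1 : ℝ))) ^ (q - 1) - q * L x ^ (q - 1)) / t *
      ((L (x + Torus.proj (t • EuclideanSpace.single i (1 : ℝ))) - L x) / t) with hG
  set g : UnitAddTorus d → ℝ := fun x => q * (q - 1) * L x ^ (q - 2) * Torus.partialDeriv i L x ^ 2
    with hg
  have hGnn : ∀ t x, 0 ≤ G t x := fun t x => slope_mul_slope_nonneg hq.le (hLnn _) (hLnn _)
  have hGc : ∀ t, Continuous (G t) := fun t => by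
    have hφc : Continuous fun x => q * L x ^ (q - 1) :=
      continuous_const.mul (hLc.rpow_const fun _ => Or.inr (by linarith))
    have hsh : Continuous fun x : UnitAddTorus d => x + Torus.proj (t • EuclideanSpace.single i (1 : ℝ)) :=
      continuous_id.add continuous_const
    exact (((hφc.comp hsh).sub hφc).div_const t).mul (((hLc.comp hsh).sub hLc).div_const t)
  have hgi : Integrable g volume := integrable_amplitudeTerm hq hv hdv i
  have hgnn : ∀ x, 0 ≤ g x := fun x =>
    mul_nonneg (mul_nonneg (mul_nonneg (by linarith) (by linarith)) (Real.rpow_nonneg (hLnn x) _))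
      (sq_nonneg _)
  -- a.e. identification of the lower limit (K57a § 1)
  have hae : ∀ᵐ x ∂(volume : Measure (UnitAddTorus d)),
      ENNReal.ofReal (g x) ≤ liminf (fun t => ENNReal.ofReal (G t x)) (𝓝[>] 0) := by
    filter_upwards [Torus.ae_differentiableAt_liftAt hK] with x hx
    rcases eq_or_lt_of_le (hLnn x) with h0 | hpos
    · have hpd : Torus.partialDeriv i L x = 0 :=
        partialDeriv_eq_zero_of_globalMin (fun z => by rw [← h0]; exact hLnn z) i
      have hg0 : g x = 0 := by simp [hg, hpd]
      rw [hg0, ENNReal.ofReal_zero]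
      exact zero_le
    · rw [(ENNReal.tendsto_ofReal (tendsto_slope_mul_slope_of_pos q hx hpos i)).liminf_eq]
  have hFatou : ∫⁻ x, ENNReal.ofReal (g x) ∂volume ≤
      liminf (fun t => ENNReal.ofReal (∫ x, G t x)) (𝓝[>] (0 : ℝ)) := by
    refine ((lintegral_mono_ae hae).trans
      (lintegral_liminf_le' fun t => (hGc t).measurable.ennreal_ofReal.aemeasurable)).trans_eq ?_
    exact liminf_congr (Eventually.of_forall fun t =>
      (ofReal_integral_eq_lintegral_ofReal (hGc t).integrable_unitAddTorus (ae_of_all _ (hGnn t))).symm)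
  rw [← ofReal_integral_eq_lintegral_ofReal hgi (ae_of_all _ hgnn)] at hFatou
  by_cases hI : 0 ≤ (∫ x, g x) - δ
  · have hlt : ENNReal.ofReal ((∫ x, g x) - δ) < liminf (fun t => ENNReal.ofReal (∫ x, G t x))
        (𝓝[>] (0 : ℝ)) :=
      lt_of_lt_of_le ((ENNReal.ofReal_lt_ofReal_iff_of_nonneg hI).2 (by linarith)) hFatou
    filter_upwards [eventually_lt_of_lt_liminf hlt] with t ht
    exact ((ENNReal.ofReal_lt_ofReal_iff_of_nonneg hI).1 ht).le
  · exact Eventually.of_forall fun t => (not_le.1 hI).le.trans (integral_nonneg (hGnn t))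

/-- **`liminf_{t→0⁺} A_t ≥ AF_q(v)` in `ε`-form, every real `q > 1`:** `∀ ε > 0, ∀ᶠ t → 0⁺,
AF_q(v) − ε ≤ A_t` (`A_t = slopeIntegral q v t`, K62). For `q ≥ 2` the tree has the limit
`A_t → AF_q`; below `2` this lower bound is what Fatou gives. [ours] -/
theorem eventually_amplitudeIntegral_sub_le_slopeIntegral (hq : 1 < q) (hv : Torus.IsSmooth v)
    (hdv : Torus.IsDivFree v) {ε : ℝ} (hε : 0 < ε) :
    ∀ᶠ t in 𝓝[>] (0 : ℝ), amplitudeIntegral q v - ε ≤ slopeIntegral q v t := by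
  have hcard : (0 : ℝ) < Fintype.card d := Nat.cast_pos.2 Fintype.card_pos
  have hδ : 0 < ε / Fintype.card d := div_pos hε hcard
  have hall := eventually_all.2 fun i => eventually_integral_amplitudeTerm_sub_le hq hv hdv i hδ
  filter_upwards [hall] with t ht
  have hsum := Finset.sum_le_sum fun i (_ : i ∈ Finset.univ) => ht i
  rw [Finset.sum_sub_distrib, Finset.sum_const, Finset.card_univ, nsmul_eq_mul,
    mul_div_cancel₀ _ hcard.ne'] at hsum
  unfold amplitudeIntegral slopeIntegral
  exact hsum

/-! ## § 3 The frame cost bounds `t⁻² F_t` from above in the limit, every real `q > 1` -/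

/-- **`limsup_{t→0⁺} t⁻² F_t ≤ FC_q(v)` in `ε`-form, every real `q > 1`, every dimension:**
`∀ ε > 0, ∀ᶠ t → 0⁺, t⁻² ∫ qλ^{q−1} FD_t ≤ FC_q(v) + ε` — K62ʼs discrete frame identity
`A_t + t⁻² F_t ≤ heat + Ct` and § 2. (For `q ≥ 2`: `t⁻² F_t → FC_q`, K62.) [ours] -/
theorem eventually_frameIntegral_div_sq_le (hq : 1 < q) (hv : Torus.IsSmooth v)
    (hdv : Torus.IsDivFree v) {ε : ℝ} (hε : 0 < ε) :
    ∀ᶠ t in 𝓝[>] (0 : ℝ), frameIntegral q v t / t ^ 2 ≤ frameCost q v + ε := by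
  obtain ⟨C, hC⟩ := exists_slope_add_frame_two_sided hq.le hv hdv
  have hA := eventually_amplitudeIntegral_sub_le_slopeIntegral hq hv hdv (half_pos hε)
  have hCt : ∀ᶠ t in 𝓝[>] (0 : ℝ), C * t ≤ ε / 2 := by
    have h : Tendsto (fun t : ℝ => C * t) (𝓝 0) (𝓝 (C * 0)) := tendsto_const_nhds.mul tendsto_id
    rw [mul_zero] at h
    exact (h.mono_left nhdsWithin_le_nhds).eventually (ge_mem_nhds (half_pos hε))
  filter_upwards [hA, hCt, self_mem_nhdsWithin] with t hAt hCt' ht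
  have h1 := (hC t ht).1
  unfold frameCost
  linarith

/-- **KILL RULE ON THE WHOLE RANGE** (`q > 1`, every dimension): heat price `≤ c·Φ_q(v)` ⟹ BOTH
`AF_q(v) ≤ c·Φ_q(v)` AND `FC_q(v) ≤ c·Φ_q(v)` (K62ʼs rule had `q ≥ 2`). No node is decided. [ours] -/
theorem amplitude_le_and_frameCost_le_of_heat_le_of_one_lt (hq : 1 < q) (hv : Torus.IsSmooth v)
    (hdv : Torus.IsDivFree v) {c : ℝ}
    (hc : heatDissipation (torusTopEigMoment q) v ≤ c * torusTopEigMoment q v) :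
    amplitudeIntegral q v ≤ c * torusTopEigMoment q v ∧ frameCost q v ≤ c * torusTopEigMoment q v := by
  have h1 := frameCost_nonneg_of_one_lt hq hv hdv
  have h2 := amplitudeIntegral_nonneg hq.le hv hdv
  unfold frameCost at h1 ⊢
  constructor <;> linarith

end AnyDim

/-! ## § 4 Localisation on the simple set, every real `q > 1` (T³) -/

section Three

variable {v : UnitAddTorus (Fin 3) → EuclideanSpace ℝ (Fin 3)} {q : ℝ}

/-- **Fatou localisation, `ℝ≥0∞` form, every real `q > 1`:** `∫⁻_{U_s(v)} qλ₁^{q−1} fd ≤ FC_q(v)`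
— Fatou along `t → 0⁺` for the non-negative grid quantities `qλ₁^{q−1} FD_t/t²` (pointwise limit
`qλ₁^{q−1} fd` on the simple set, K63) against the eventual bound `t⁻² F_t ≤ FC_q + ε` of § 3. [ours] -/
theorem lintegral_simpleSet_frameDensity_le_of_one_lt (hq : 1 < q) (hv : Torus.IsSmooth v)
    (hdv : Torus.IsDivFree v) :
    ∫⁻ x in simpleSet v, ENNReal.ofReal (q * torusStrainTopEig v x ^ (q - 1) * frameDensity v x) ≤
      ENNReal.ofReal (frameCost q v) := by
  have hlam : ∀ x, 0 ≤ torusStrainTopEig v x := fun x => by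
    rw [← lam_strainFlat]; exact lam_strainFlat_nonneg hv hdv x
  set g : ℝ → UnitAddTorus (Fin 3) → ℝ :=
    fun t x => q * torusStrainTopEig v x ^ (q - 1) * frameDefect v t x / t ^ 2 with hg
  have hg_int : ∀ t, Integrable (g t) volume := fun t =>
    (integrable_weight_mul_frameDefect hq.le hv t).div_const _
  have hg_nn : ∀ t x, 0 ≤ g t x := fun t x =>
    div_nonneg (mul_nonneg (mul_nonneg (by linarith) (Real.rpow_nonneg (hlam x) _))
      (frameDefect_nonneg v t x)) (sq_nonneg t)
  have hgF : ∀ t, ∫ x, g t x = frameIntegral q v t / t ^ 2 := fun t => by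
    simp only [hg, frameIntegral]
    exact integral_div _ _
  have hU : MeasurableSet (simpleSet v) := (isOpen_simpleSet hv).measurableSet
  have hlim : liminf (fun t => ENNReal.ofReal (∫ x, g t x)) (𝓝[>] (0 : ℝ)) ≤
      ENNReal.ofReal (frameCost q v) := by
    refine ENNReal.le_of_forall_pos_le_add fun ε hε _ => ?_
    have hev : ∀ᶠ t in 𝓝[>] (0 : ℝ), ENNReal.ofReal (∫ x, g t x) ≤
        ENNReal.ofReal (frameCost q v) + ε := by
      filter_upwards [eventually_frameIntegral_div_sq_le hq hv hdv (ε := ε) (by exact_mod_cast hε)]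
        with t ht
      rw [hgF t, ← ENNReal.ofReal_coe_nnreal, ← ENNReal.ofReal_add (frameCost_nonneg_of_one_lt hq hv hdv)
        ε.coe_nonneg]
      exact ENNReal.ofReal_le_ofReal ht
    exact liminf_le_of_frequently_le hev.frequently
  calc ∫⁻ x in simpleSet v, ENNReal.ofReal (q * torusStrainTopEig v x ^ (q - 1) * frameDensity v x)
      = ∫⁻ x in simpleSet v, liminf (fun t => ENNReal.ofReal (g t x)) (𝓝[>] 0) := by
        refine setLIntegral_congr_fun hU fun x hx => ?_
        exact ((ENNReal.tendsto_ofReal (tendsto_weight_frameDefect_div_sq hv hx q)).liminf_eq).symm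
    _ ≤ liminf (fun t => ∫⁻ x in simpleSet v, ENNReal.ofReal (g t x)) (𝓝[>] 0) :=
        lintegral_liminf_le' fun t => (hg_int t).aemeasurable.ennreal_ofReal.restrict
    _ ≤ liminf (fun t => ∫⁻ x, ENNReal.ofReal (g t x)) (𝓝[>] 0) :=
        liminf_le_liminf (Eventually.of_forall fun t => setLIntegral_le_lintegral _ _)
    _ = liminf (fun t => ENNReal.ofReal (∫ x, g t x)) (𝓝[>] 0) :=
        liminf_congr (Eventually.of_forall fun t =>
          (ofReal_integral_eq_lintegral_ofReal (hg_int t) (ae_of_all _ (hg_nn t))).symm)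
    _ ≤ ENNReal.ofReal (frameCost q v) := hlim

/-- **Fatou localisation of the frame cost, every real `q > 1`** (smooth divergence-free `v` on `T³`):
`qλ₁^{q−1} fd` is integrable on the simple set `U_s(v) = {λ₂ < λ₁}` and `∫_{U_s(v)} qλ₁^{q−1} fd ≤ FC_q(v)`
(K63 had `q ≥ 2`). [ours] -/
theorem setIntegral_simpleSet_frameDensity_le_frameCost_of_one_lt (hq : 1 < q)
    (hv : Torus.IsSmooth v) (hdv : Torus.IsDivFree v) :
    IntegrableOn (fun x => q * torusStrainTopEig v x ^ (q - 1) * frameDensity v x) (simpleSet v)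
        volume ∧
      ∫ x in simpleSet v, q * torusStrainTopEig v x ^ (q - 1) * frameDensity v x ≤ frameCost q v := by
  have hlam : ∀ x, 0 ≤ torusStrainTopEig v x := fun x => by
    rw [← lam_strainFlat]; exact lam_strainFlat_nonneg hv hdv x
  have hU : MeasurableSet (simpleSet v) := (isOpen_simpleSet hv).measurableSet
  set G : UnitAddTorus (Fin 3) → ℝ :=
    fun x => q * torusStrainTopEig v x ^ (q - 1) * frameDensity v x with hG
  have hGm : AEStronglyMeasurable G (volume.restrict (simpleSet v)) :=
    aestronglyMeasurable_of_tendsto_ae (𝓝[>] (0 : ℝ))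
      (f := fun t x => q * torusStrainTopEig v x ^ (q - 1) * frameDefect v t x / t ^ 2)
      (fun t => ((integrable_weight_mul_frameDefect hq.le hv t).div_const _).aestronglyMeasurable.restrict)
      ((ae_restrict_iff' hU).2 (ae_of_all _ fun x hx => tendsto_weight_frameDefect_div_sq hv hx q))
  have hG0 : 0 ≤ᵐ[volume.restrict (simpleSet v)] G :=
    (ae_restrict_iff' hU).2 (ae_of_all _ fun x hx =>
      mul_nonneg (mul_nonneg (by linarith) (Real.rpow_nonneg (hlam x) _))
        (frameDensity_nonneg_of_mem hv hx))
  have hlin := lintegral_simpleSet_frameDensity_le_of_one_lt hq hv hdv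
  have hfin : HasFiniteIntegral G (volume.restrict (simpleSet v)) := by
    rw [hasFiniteIntegral_iff_ofReal hG0]
    exact lt_of_le_of_lt hlin ENNReal.ofReal_lt_top
  refine ⟨⟨hGm, hfin⟩, ?_⟩
  rw [integral_eq_lintegral_of_nonneg_ae hG0 hGm]
  exact ENNReal.toReal_le_of_le_ofReal (frameCost_nonneg_of_one_lt hq hv hdv) hlin

/-- **KILL RULE, frame half, every real `q > 1`, NO simplicity hypothesis:** heat price `≤ c·Φ_q(v)` ⟹
`∫_{U_s(v)} qλ₁^{q−1} fd ≤ c·Φ_q(v)` — along a killing family for L-λ(q) the gap-weighted turning of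
the top eigenframe is `o(Φ_q)` on the simple set, for EVERY exponent of the open node. [ours] -/
theorem setIntegral_simpleSet_frameDensity_le_of_heat_le_of_one_lt (hq : 1 < q)
    (hv : Torus.IsSmooth v) (hdv : Torus.IsDivFree v) {c : ℝ}
    (hc : heatDissipation (torusTopEigMoment q) v ≤ c * torusTopEigMoment q v) :
    ∫ x in simpleSet v, q * torusStrainTopEig v x ^ (q - 1) * frameDensity v x ≤
      c * torusTopEigMoment q v := by
  have h := (amplitude_le_and_frameCost_le_of_heat_le_of_one_lt hq hv hdv hc).2
  exact (setIntegral_simpleSet_frameDensity_le_frameCost_of_one_lt hq hv hdv).2.trans h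

end Three

end FrameFloor

end TopEig

end Summit.NavierStokesRegularity.FunctionalMining

end
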